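import Summits.QuantumFields.BalabanUV.Beta.GAN24.TaylorRowVSupport
import Summits.QuantumFields.BalabanUV.Beta.GAN24.TaylorMassVHSymAt

/-!
# `BalabanUV.Beta.GAN24.TaylorRowVSupportSymAt` (SYMMETRIC comb table, OWNER W15; the `borderIncAt` twin is `TaylorRowVSupportAt` p298199) — binder row G-an2-4 / (CONV-C), road S3 AT THE IN-BLOCK ROOT, V half: package (ρV-b), part 1, of «ROOTED-S3-V»
# (OWNER gan24-p1-g21 (W11) «GO NOW, WANTED»; `gen21/BORNV-PLAN-v0.md` §3) — **`TaylorRowVSupport.pushSum_borderInc_inr_inl_ne_zero` FOR an2's ROOTED BORDER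
# SYMMETRIC BORDER SUM `DecLiftAdjoint.borderSum M (vhSAt (toSite r) d Lc)`** (box root, no `mfNeg`): the (multiplier, field)-block support of the pushed rooted border sum.  The base module's
# arithmetic (`radii_div_le`, `count_mul_mass_le`, `prefactor_eq`, `abs_tsum_add_le_of_sum_abs_le`) is root-free and used BY NAME by (ρV-b) part 2 `TaylorRowVAt`.

NOT IN PRINT; OUR BOOKKEEPING (unit `b2b-balaban-gan24-p2`, gen 33 = prover-b2b-balaban-gan24-p2-g33-0, road-P2 chair of row G-an2-4; CRUX TEAM (2), 2026-08-21; mkroot METHOD as in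
leaf-01 g60's (ρ-a) p296041 and MY (ρV-a) `TaylorMassVHAt`: same statement with `borderInc d Lc M κ u ↦ borderSum M (fun κ₀ z₀ => vhSAt (toSite r) d Lc rfl κ₀ z₀) κ u`, one extra binder `(hr : r ∈ box (d+1) Lc)`, MY
`TaylorMassVHAt.borderSumV_ne_zero` in place of VH1's `borderInc_ne_zero`; base modules untouched).  [folklore]; 0 `def`, 0 cited facts, 0 `def … : Prop`, 0 sorry; NO
estimate of Bałaban's.  HONEST FRAMING (cell contract, verbatim): «discharging `BetaPertH` makes Bałaban's UV stability UNCONDITIONAL — a real constructive-QFT result; it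
is NOT the continuum limit and NOT the Clay problem.»  HONEST DEPENDENCY (verbatim): «continuum YM on T⁴ ⇐ BetaPertH ∧ nine spine estimates (0/9 proved); BetaPertH ⇐ (D1)
∧ (D4) ∧ CAP+tail; G-an2-4 gates asym, D1 and NE2/3/4.»  Discharges NOTHING of (hS, hSall) ∕ hB; NEVER «G-an2-4 closed»; NOT D1, NOT BetaPertH, NOT continuum, NOT Clay.
-/

noncomputable section

open Finset
open scoped BigOperators
open Literature.MathematicalPhysics.QuantumFieldTheory
open Literature.MathematicalPhysics.QuantumFieldTheory.Balaban1983to89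
open Literature.MathematicalPhysics.QuantumFieldTheory.Balaban1983to89.Beta
open Literature.Probability.LatticeModels (Torus.proj)
open LatticeForm (quo)
open B12Sec2to5 (l1 l1_nonneg)
open ExpKernelCalculus (MKer l1_natSmul l1_sub_triangle l1_sub_symm)
open OneStepResolventKernel (Fib eq_zsmul_quo_of_proj quo_zsmul proj_zsmul)
open OneStepKernelFamily (LegIdx legPt)
open AffineAveraging (box toSite)
open BalabanCompositeJets (pushSum)
open DecLiftAdjoint (borderSum)
open AveragingHessianKernelsRooted (vhSAt)
open Summit.QuantumFields.BalabanUV.Beta.GAN24.PushSumNest (pushSum_inr_of_proj_ne)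
open Summit.QuantumFields.BalabanUV.Beta.GAN24.TaylorMassVHSymAt (borderSumV_ne_zero)
open Summit.QuantumFields.BalabanUV.Beta.GAN24.TaylorMassVHPush (pushSum_inr_inl_coarse_sum)

namespace Summit.QuantumFields.BalabanUV.Beta.GAN24.TaylorRowVSupportSymAt

variable {d : ℕ} {Lc : ℕ} [NeZero Lc]

/-- [folklore] **SUPPORT OF THE PUSHED INCREMENT, (multiplier, field) block** (the twin of VH1's
`TaylorMassVHAt.pushSum_borderSumV_inl_inr_ne_zero`, ROOTED, box root): a nonzero entry has its multiplier leg (first site, a point of the new coarse lattice)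
within `R_V·M + 2(d+1)·L·(M·Lc)` of the fine bond `u` and its field leg (second site) within `R_V·M`. -/
theorem pushSum_borderSumV_inr_inl_ne_zero (M L : ℕ) [NeZero M] [NeZero L] (hL : 1 ≤ Lc) {r : Fin (d + 1) → ℕ} (hr : r ∈ box (d + 1) Lc)
    {κ : Fin (d + 1)}
    {u x y : Fin (d + 1) → ℤ} {μ α : Fin (d + 1)}
    (h : pushSum (M * Lc) L (borderSum M (fun κ₀ z₀ => vhSAt (toSite r) d Lc rfl κ₀ z₀) κ u) x y (Sum.inr μ) (Sum.inl α) ≠ 0) :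
    l1 (x - u) ≤ ((2 * (d + 1) * (Lc + 1) + (2 * d + 3)) * M : ℕ) + 2 * ((d : ℝ) + 1) * L * (M * Lc : ℕ) ∧
      l1 (y - u) ≤ ((2 * (d + 1) * (Lc + 1) + (2 * d + 3)) * M : ℕ) := by
  have hproj : Torus.proj (M * Lc * L) x = 0 := by
    by_contra hne; exact h (pushSum_inr_of_proj_ne (M * Lc) L hne _ y μ _)
  have ex := eq_zsmul_quo_of_proj (N := M * Lc * L) hproj
  rw [ex, pushSum_inr_inl_coarse_sum] at h
  obtain ⟨i', hi', hne⟩ := Finset.exists_ne_zero_of_sum_ne_zero h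
  obtain ⟨hx, hy⟩ := borderSumV_ne_zero M hL hr hne
  refine ⟨?_, hy⟩
  set W' := quo (M * Lc * L) x with hW'
  have hoff : l1 (legPt L (Sum.inl μ : Fib d) W' i' - (L : ℤ) • W') ≤ 2 * (d + 1) * L :=
    OneStepKernelFamily.l1_legPt_sub_le L (Sum.inl μ : Fib d) W' hi'
  have e1 : (((M * Lc * L : ℕ) : ℤ)) • W' = ((M * Lc : ℕ) : ℤ) • ((L : ℤ) • W') := by rw [smul_smul]; push_cast; ring_nf
  have hdist : l1 ((((M * Lc * L : ℕ) : ℤ)) • W' - ((M * Lc : ℕ) : ℤ) • legPt L (Sum.inl μ : Fib d) W' i') ≤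
      2 * ((d : ℝ) + 1) * L * (M * Lc : ℕ) := by
    rw [e1, ← smul_sub, l1_natSmul, l1_sub_symm]
    have hMLc : (0 : ℝ) ≤ (M * Lc : ℕ) := Nat.cast_nonneg _
    calc ((M * Lc : ℕ) : ℝ) * l1 (legPt L (Sum.inl μ : Fib d) W' i' - (L : ℤ) • W') ≤ ((M * Lc : ℕ) : ℝ) * (2 * (d + 1) * L) :=
          mul_le_mul_of_nonneg_left hoff hMLc
      _ = 2 * ((d : ℝ) + 1) * L * (M * Lc : ℕ) := by ring
  rw [← ex] at hdist
  have tri := l1_sub_triangle x (((M * Lc : ℕ) : ℤ) • legPt L (Sum.inl μ : Fib d) W' i') u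
  linarith

end Summit.QuantumFields.BalabanUV.Beta.GAN24.TaylorRowVSupportSymAt

end
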